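import Literature.Probability.LatticeModels.DartPhase
import Literature.Probability.LatticeModels.DirichletGreenFunction
import Literature.Probability.RandomPlanarGeometry.PlanarDomains
import Summits.CriticalPhenomena.CardyFormulaZ2.Theorems.CardySusyWardParafermionPrecompactKenyonDefs
import Summits.CriticalPhenomena.CardyFormulaZ2.Theorems.CardySusyWardParafermionPrecompactGreenMajorantStencil

/-!
# Stub `stub_greenMajorant` of the line `kenyon-stream-second-relation` (crux `ParafermionPrecompact`)

Route `CardySusyWard`, item stmt-CriticalPhenomena-11293, lead
`prover-line-stmt-CriticalPhenomena-11293-0`. The GREEN MAJORANT WITH GRADIENT WEIGHTS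
(deterministic discrete potential theory on `ℤ²`, vocabulary of `…KenyonDefs`): for every finite
`Λ ⊆ ℤ²` and every function `Φ` on corners whose vertex residual `vRes Φ` vanishes on the edges
within sup-distance `1` of `Λ` (`nearEdges Λ`), every class component `g_q = classComp Φ q`
satisfies at every `x₀ ∈ Λ`

  `‖g_q(x₀)‖ ≤ Σ_{p ∈ nearEdges Λ} greenWeight Λ x₀ q p · ‖sRes Φ p‖ + Σ_{w ∈ ∂Λ} H_Λ(x₀,w) ‖g_q(w)‖`

and the pair form with `greenWeight₂` / `|H_Λ(x₀,·) - H_Λ(x₁,·)|` (`stub_greenMajorant`, verbatim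
the skeleton's `Sig.stub_greenMajorant`).

Proof.
* GREEN'S REPRESENTATION (tree: `green_representation`, Lawler 1991 §1.5, applied to `Re g` and
  `Im g`; `green_representation_complex`): for `x ∈ Λ`,
  `g(x) = Σ_{y ∈ Λ} G_Λ(x,y) (-Δ g)(y) + Σ_{w ∈ ∂Λ} H_Λ(x,w) g(w)` with the graph Laplacian
  `Δ g (y) = Σᵢ (g(y + eᵢ) + g(y - eᵢ)) - 4 g(y)`.
* THE KENYON STENCIL in Green-pairing form (`stencil_pairing`, file `…GreenMajorantStencil`):
  there are tables `a, b` of modulus `≤ 1` with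
  `Σ_{y ∈ Λ} h(y) Δg_q(y) = Σ_{p ∈ nearEdges Λ} sRes Φ p · W_h(p)`,
  `W_h(p) = a q i (h(y') - h(y'+eᵢ)) + b q i (h(faceA p - c_q) - h(faceB p - c_q))`, for every `h`
  vanishing off `Λ` — applied to `h = G_Λ(x,·)` (`dirichletGreen_of_not_mem_right`):
  `g_q(x) = -Σ_p sRes Φ p · W_x(p) + Σ_w H_Λ(x,w) g_q(w)` (`classComp_eq_rep`).
* NORMS: `‖W_x(p)‖ ≤ greenWeight Λ x q p` and `‖W_{x₀}(p) - W_{x₁}(p)‖ ≤ greenWeight₂ Λ x₀ x₁ q p`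
  (`norm_combo_le`, `‖a‖, ‖b‖ ≤ 1`); the triangle inequality and `H_Λ ≥ 0`
  (`poissonKernel_nonneg`) give clause (i), and subtracting the two representations at
  `x₀, x₁ ∈ Λ` before taking norms gives clause (ii).

References: G. F. Lawler, *Intersections of Random Walks* (1991), §1.4–1.5 [Lawler1991];
R. Kenyon, Invent. Math. 150 (2002) 409–439, §3; H. Duminil-Copin, S. Smirnov, Clay Math. Proc.
15 (2012), §8.3 [DuminilCopinSmirnov2012Lattice]. Elementary finite estimates, tagged
`[folklore]`.
-/

noncomputable section

namespace Summit.CriticalPhenomena.CardyFormulaZ2.Cruxes.ParafermionPrecompact.KenyonStreamSecondRelation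

open scoped BigOperators
open _root_.Literature.Probability.LatticeModels

/-- **Green's representation formula** for a complex function on `ℤ²` (from the tree's real
`green_representation`, Lawler 1991 §1.5, applied to real and imaginary parts):
`g(x) = Σ_{y ∈ Λ} G_Λ(x,y) (-Δ g)(y) + Σ_{z ∈ ∂Λ} H_Λ(x,z) g(z)` for `x ∈ Λ`. [folklore] -/
theorem green_representation_complex (Λ : Finset (Site 2)) (g : Site 2 → ℂ) {x : Site 2}
    (hx : x ∈ Λ) :
    g x = (∑ y ∈ Λ, (dirichletGreen Λ x y : ℂ) *
        -((∑ i : Fin 2, (g (y + ex i) + g (y - ex i))) - 4 * g y)) +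
      ∑ z ∈ outerBoundary (zdGraph 2) Λ, (poissonKernel Λ x z : ℂ) * g z := by
  have hre : ∀ y, ((∑ i : Fin 2, (g (y + ex i) + g (y - ex i))) - 4 * g y).re =
      latticeLaplacianZd (fun v => (g v).re) y := fun y => by
    simp only [latticeLaplacianZd, ex, Complex.sub_re, Complex.re_sum, Complex.add_re,
      Complex.mul_re, Complex.re_ofNat, Complex.im_ofNat, zero_mul, sub_zero, Nat.cast_ofNat]
    ring
  have him : ∀ y, ((∑ i : Fin 2, (g (y + ex i) + g (y - ex i))) - 4 * g y).im =
      latticeLaplacianZd (fun v => (g v).im) y := fun y => by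
    simp only [latticeLaplacianZd, ex, Complex.sub_im, Complex.im_sum, Complex.add_im,
      Complex.mul_im, Complex.re_ofNat, Complex.im_ofNat, zero_mul, add_zero, Nat.cast_ofNat]
    ring
  apply Complex.ext
  · simp only [Complex.add_re, Complex.re_sum, Complex.re_ofReal_mul, Complex.neg_re, hre]
    exact green_representation two_pos Λ (fun v => (g v).re) hx
  · simp only [Complex.add_im, Complex.im_sum, Complex.im_ofReal_mul, Complex.neg_im, him]
    exact green_representation two_pos Λ (fun v => (g v).im) hx

/-- **Green's representation with gradient weights.** If the stencil holds in Green-pairing form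
for the tables `a, b` and `vRes Φ` vanishes on `nearEdges Λ`, then for `x ∈ Λ`,
`g_q(x) = -Σ_{p ∈ nearEdges Λ} sRes Φ p · W_x(p) + Σ_{w ∈ ∂Λ} H_Λ(x,w) g_q(w)` with
`W_x(p) = a q i (G(x,y') - G(x,y'+eᵢ)) + b q i (G(x,faceA p - c_q) - G(x,faceB p - c_q))`.
[folklore] -/
theorem classComp_eq_rep {a b : Fin 4 → Fin 2 → ℂ} (Λ : Finset (Site 2))
    (Φ : Site 2 × Site 2 → ℂ) (q : Fin 4)
    (hst : ∀ h : Site 2 → ℂ, (∀ y ∉ Λ, h y = 0) →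
      ∑ y ∈ Λ, h y *
          ((∑ i : Fin 2, (classComp Φ q (y + ex i) + classComp Φ q (y - ex i))) -
            4 * classComp Φ q y) =
        ∑ p ∈ nearEdges Λ, sRes Φ p * (a q p.2 * (h p.1 - h (p.1 + ex p.2)) +
          b q p.2 * (h (faceA p - classOffset q) - h (faceB p - classOffset q))))
    {x : Site 2} (hx : x ∈ Λ) :
    classComp Φ q x =
      -(∑ p ∈ nearEdges Λ, sRes Φ p *
          (a q p.2 * ((dirichletGreen Λ x p.1 : ℂ) - dirichletGreen Λ x (p.1 + ex p.2)) +
            b q p.2 * ((dirichletGreen Λ x (faceA p - classOffset q) : ℂ) -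
              dirichletGreen Λ x (faceB p - classOffset q)))) +
        ∑ z ∈ outerBoundary (zdGraph 2) Λ, (poissonKernel Λ x z : ℂ) * classComp Φ q z := by
  rw [green_representation_complex Λ (classComp Φ q) hx, ← hst (fun y => (dirichletGreen Λ x y : ℂ))
    fun y hy => by rw [dirichletGreen_of_not_mem_right Λ x hy, Complex.ofReal_zero],
    ← Finset.sum_neg_distrib]
  simp only [mul_neg]

/-- `‖c (r₁ - r₂) + d (r₃ - r₄)‖ ≤ |r₁ - r₂| + |r₃ - r₄|` for `‖c‖, ‖d‖ ≤ 1` and real `rₖ`.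
[folklore] -/
theorem norm_combo_le {c d : ℂ} (hc : ‖c‖ ≤ 1) (hd : ‖d‖ ≤ 1) (r₁ r₂ r₃ r₄ : ℝ) :
    ‖c * ((r₁ : ℂ) - r₂) + d * ((r₃ : ℂ) - r₄)‖ ≤ |r₁ - r₂| + |r₃ - r₄| := by
  refine (norm_add_le _ _).trans (add_le_add ?_ ?_)
  · rw [norm_mul, ← Complex.ofReal_sub, Complex.norm_real, Real.norm_eq_abs]
    exact mul_le_of_le_one_left (abs_nonneg _) hc
  · rw [norm_mul, ← Complex.ofReal_sub, Complex.norm_real, Real.norm_eq_abs]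
    exact mul_le_of_le_one_left (abs_nonneg _) hd

/-- **Registered stub 3 (`stub_greenMajorant`): the Green majorant with gradient weights.** For
every finite `Λ ⊆ ℤ²` and every corner function `Φ` whose vertex residual vanishes on
`nearEdges Λ`, every class component is bounded at `x₀ ∈ Λ` by the `greenWeight`-weighted sum of
the moduli of the sum residuals plus the Poisson average of its boundary moduli, and the
difference of its values at `x₀, x₁ ∈ Λ` by the `greenWeight₂` / `|H_Λ(x₀,·) - H_Λ(x₁,·)|` form.
[folklore] -/
theorem stub_greenMajorant :
    ∀ (Λ : Finset (Site 2)) (Φ : Site 2 × Site 2 → ℂ), (∀ p ∈ nearEdges Λ, vRes Φ p = 0) →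
      ∀ (q : Fin 4) (x₀ : Site 2), x₀ ∈ Λ →
        ‖classComp Φ q x₀‖ ≤
            (∑ p ∈ nearEdges Λ, greenWeight Λ x₀ q p * ‖sRes Φ p‖) +
              ∑ w ∈ outerBoundary (zdGraph 2) Λ,
                Literature.Probability.LatticeModels.poissonKernel Λ x₀ w * ‖classComp Φ q w‖ ∧
          ∀ x₁ ∈ Λ,
            ‖classComp Φ q x₀ - classComp Φ q x₁‖ ≤
              (∑ p ∈ nearEdges Λ, greenWeight₂ Λ x₀ x₁ q p * ‖sRes Φ p‖) +
                ∑ w ∈ outerBoundary (zdGraph 2) Λ,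
                  |Literature.Probability.LatticeModels.poissonKernel Λ x₀ w -
                      Literature.Probability.LatticeModels.poissonKernel Λ x₁ w| * ‖classComp Φ q w‖ := by
  intro Λ Φ hv q x₀ hx₀
  obtain ⟨a, b, hn, hst⟩ := stencil_pairing
  have rep := fun x (hx : x ∈ Λ) => classComp_eq_rep Λ Φ q (hst Λ Φ hv q) hx
  refine ⟨?_, fun x₁ hx₁ => ?_⟩
  · rw [rep x₀ hx₀]
    refine (norm_add_le _ _).trans (add_le_add ?_ ?_)
    · rw [norm_neg]
      refine (norm_sum_le _ _).trans (Finset.sum_le_sum fun p _ => ?_)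
      rw [norm_mul, mul_comm]
      exact mul_le_mul_of_nonneg_right (norm_combo_le (hn q p.2).1 (hn q p.2).2 _ _ _ _)
        (norm_nonneg _)
    · refine (norm_sum_le _ _).trans (le_of_eq (Finset.sum_congr rfl fun w _ => ?_))
      rw [norm_mul, Complex.norm_real, Real.norm_of_nonneg (poissonKernel_nonneg two_pos Λ x₀ w)]
  · have e : classComp Φ q x₀ - classComp Φ q x₁ =
        -(∑ p ∈ nearEdges Λ, sRes Φ p *
          (a q p.2 * (((dirichletGreen Λ x₀ p.1 - dirichletGreen Λ x₁ p.1 : ℝ) : ℂ) -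
              ((dirichletGreen Λ x₀ (p.1 + ex p.2) - dirichletGreen Λ x₁ (p.1 + ex p.2) : ℝ) : ℂ)) +
            b q p.2 * (((dirichletGreen Λ x₀ (faceA p - classOffset q) -
                dirichletGreen Λ x₁ (faceA p - classOffset q) : ℝ) : ℂ) -
              ((dirichletGreen Λ x₀ (faceB p - classOffset q) -
                dirichletGreen Λ x₁ (faceB p - classOffset q) : ℝ) : ℂ)))) +
          ∑ w ∈ outerBoundary (zdGraph 2) Λ,
            ((poissonKernel Λ x₀ w - poissonKernel Λ x₁ w : ℝ) : ℂ) * classComp Φ q w := by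
      rw [rep x₀ hx₀, rep x₁ hx₁]
      simp only [mul_sub, mul_add, Finset.sum_sub_distrib, Finset.sum_add_distrib,
        Complex.ofReal_sub, sub_mul]
      ring
    rw [e]
    refine (norm_add_le _ _).trans (add_le_add ?_ ?_)
    · rw [norm_neg]
      refine (norm_sum_le _ _).trans (Finset.sum_le_sum fun p _ => ?_)
      rw [norm_mul, mul_comm]
      exact mul_le_mul_of_nonneg_right (norm_combo_le (hn q p.2).1 (hn q p.2).2 _ _ _ _)
        (norm_nonneg _)
    · refine (norm_sum_le _ _).trans (le_of_eq (Finset.sum_congr rfl fun w _ => ?_))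
      rw [norm_mul, Complex.norm_real, Real.norm_eq_abs]

end Summit.CriticalPhenomena.CardyFormulaZ2.Cruxes.ParafermionPrecompact.KenyonStreamSecondRelation

end
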